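import Summits.BirchSwinnertonDyer.BirchSwinnertonDyer.Theorems.AlignedTransportAtTwoMainConjectureOfRankZeroBSDAtTwoHalfDescentLayerIndexGrowthFiniteTwistMinus
import Summits.BirchSwinnertonDyer.BirchSwinnertonDyer.Theorems.ByReductionTypeAtTwoOrdKatoHalfAtTwoIsoRubinTauAtTwo
import Literature.NumberTheory.EllipticCurves.QuadraticTwistSelmerInfty
import Literature.NumberTheory.EllipticCurves.TwoVariableAnticyclotomicControl
import HarnessLib

/-!
# Route `AlignedTransportAtTwo`, crux C2 `MainConjectureOfRankZeroBSDAtTwo` (stmt-BirchSwinnertonDyer-22298):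
# THE TWIST READING OF THE MINUS PART, III — THE QUADRATIC TWIST AT THE FIRST LAYER: for `K_1 = K(√d)` the first layer of a `ℤ₂`-extension of ANY number field `K`
# and `W` on the seed cell (`W(K)[2] = 0`): `#Sel_{2^∞}(W^{(d)}/K) ∣ #M_1 ∣ #Sel_{2^∞}(W^{(d)}/K) · #M_1[2]` (`M_1 = ker(N_{K_1/K} | Sel_{2^∞}(W/K_1))`, gen 57's signed object at
# finite level), `#Sel(W/K)·#Sel(W^{(d)}/K) ∣ #Sel(W/K_1)·#M_1[2]`, `#Sel(W/K_1) ∣ #Sel(W/K)·#Sel(W^{(d)}/K)·#Sel⁺_1[2]·#M_1[2]`, `2^{μ(X(W/K_∞))} ∣ #Sel_{2^∞}(W^{(d)}/K)·#M_1[2]·#ker g_1`;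
# over `ℚ` with `κ` cyclotomic (`ℚ_1 = ℚ(√2)`, tree): the same for `E^{(2)}`, hypothesis-free except the crux binder `∀ x, ¬ HasRationalTwoTorsionX E x`

HONEST FRAMING (cell `bsd-f1-sign2`, WIDTH-5 attached prover seat `bsd-line-att-p5` gen 58 on line `birth` of the lead `bsd-line-att-p2`;
`--supports` stmt-BirchSwinnertonDyer-22298, closes nothing; BSD is NOT proved by any of this; the crux C2, its verdict «blocked-on
`Rank1Residual.GreenbergMuConjectureIrreducible`» and every registered stub (P / T / Kμ / LimDoor / MuIneqʳ / PFμ⁺) are untouched). THEOREMS ONLY — no `def`,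
no instance, no named fact, no `sorry`. Sequel of `…GrowthFiniteTwistMinus` (abstract twisting datum `Ψ`): here the datum is DISCHARGED for the tree's quadratic
twist `W.quadraticTwist d` by `QuadraticTwistSelmer.twistH1Equiv` (file `QuadraticTwistSelmerInfty`: `Sel_{2^∞}(W^{(d)}/L) ≅ Sel_{2^∞}(W/L)` for `√d ∈ L`, sign rule
`Ψ ∘ conj_σ = χ_θ(σ)·conj_σ ∘ Ψ`) at `L = K_1 = K(√d)` (`Gal(K̄/K_1)` fixes `θ = √d`, `γθ = −θ`), and the injectivity of `res : H¹(K, W^{(d)}[2^∞]) → H¹(K_1, W^{(d)}[2^∞])` on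
the seed cell is derived from `W(K)[2] = 0` through the `Gal(K̄/K_1)`-equivariant isomorphism `W^{(d)}[2^∞] ≃ W[2^∞]` (tree `fixedPoints_kerSubgroup_geomPrimaryTorsion_eq_bot`,
inflation–restriction `resOfLe_injective_of_forall_fixed_eq_zero`). Why the FIRST layer: a twisting element `d ∈ K` with `√d ∈ K_{n+1} ∖ K_n` exists only for `n = 0`
(`Gal(K_{n+1}/K)` is cyclic); the layer `K_{n+1}/K_n` is the first layer of the re-based tower `K_∞/K_n` with `d_n ∈ K_n` — over `ℚ`: `ℚ_1 = ℚ(√2)`, `ℚ_2 = ℚ_1(√(2+√2))`,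
`ℚ_3 = ℚ_2(√(2+√(2+√2)))` — and the theorems below apply verbatim over the base `K_n`.

* §1 `exists_twistDatum` — the datum `(Ψ, hΨsel, hΨγ)` of `…GrowthFiniteTwistMinus` for `W′ = W^{(d)}` at `K_1 = K(√d)`; `forall_fixed_quadraticTwist_eq_zero`,
  `resOfLe_quadraticTwist_injective` — `W(K)[2] = 0 ⟹ W^{(d)}[2^∞]^{Gal(K̄/K_1)} = 0 ⟹ res′ injective`.
* §2 (any `K`) ★★★ `natCard_selmerLayer_quadraticTwist_dvd_and_dvd`: **`#Sel_{2^∞}(W^{(d)}/K) ∣ #M_1 ∣ #Sel_{2^∞}(W^{(d)}/K) · #M_1[2]`**;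
  ★★ `natCard_selmerLayer_mul_quadraticTwist_dvd`: **`#Sel_{2^∞}(W/K) · #Sel_{2^∞}(W^{(d)}/K) ∣ #Sel_{2^∞}(W/K_1) · #M_1[2]`**; ★★ `natCard_selmerLayer_one_dvd`:
  **`#Sel_{2^∞}(W/K_1) ∣ #Sel_{2^∞}(W/K) · #Sel_{2^∞}(W^{(d)}/K) · #Sel⁺_1[2] · #M_1[2]`** (the order form of Dokchitser–Dokchitser's Lemma 4.14 with explicit `2`-torsion defects);
  ★★ `pow_mu_dvd_quadraticTwist`: **`2^{μ(X(W/K_∞))} ∣ #Sel_{2^∞}(W^{(d)}/K) · #M_1[2] · #ker g_1`** — `μ ≤ v₂#Sel_{2^∞}(W^{(d)}/K) + v₂#M_1[2] + v₂#ker g_1`, an UPPER BOUND for `μ`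
  by the `2^∞`-descent of the twist over the BASE (any rank, `X` f.g. torsion).
* §3 (`K = ℚ`, `κ` cyclotomic, `ℚ_1 = ℚ(√2)`: tree `SteinbergFibreAtTwo.exists_sqrt_two_smul_eq_neg_of_isCyclotomic`) ★★★ `natCard_selmerLayer_quadraticTwist_two_dvd_and_dvd`,
  ★★ `natCard_selmerLayer_mul_quadraticTwist_two_dvd`, ★★ `natCard_selmerLayer_one_dvd_two`, ★★ `pow_mu_dvd_quadraticTwist_two`:
  **`2^{μ₂(X(E/ℚ_∞))} ∣ #Sel_{2^∞}(E^{(2)}/ℚ) · #M_1[2] · #ker g_1`** for every elliptic `E/ℚ` without a rational `2`-torsion abscissa (the crux binder), every cyclotomic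
  datum — `μ₂` (the seed's only non-print input) is bounded by HONEST descent data over `ℚ` of the twist `E^{(2)}` and over `ℚ(√2)`.
What is NOT claimed: nothing numerical about any curve; no Selmer group computed; C2 untouched. Memo `Cruxes/MainConjectureOfRankZeroBSDAtTwo/TWIST-READING-att-p5-g58.md`.

References: T. Dokchitser, V. Dokchitser, Ann. of Math. 172 (2010), Lemma 4.14 (proof) [DokchitserDokchitserAnnals2010]; T. Dokchitser, *Notes on the parity conjecture*
(2013) §4 [Dokchitser2013ParityNotes]; R. Greenberg, LNM 1716 (1999), §1, Conj. 1.11, §3 Lemmas 3.1–3.3, §4 p. 107, Lemma 4.3 [GreenbergLNM1716]; J. H. Silverman, *AEC*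
X.2 Prop. 2.4, X.5 Cor. 5.4 [SilvermanAEC2009]; L. Washington, GTM 83 §13.1 (`ℚ_1 = ℚ(√2)`), §13.3 [Washington1997]; J.-P. Serre, *Galois Cohomology*, I.§2.4–2.6 [SerreGaloisCohomology1997].
-/

set_option linter.dupNamespace false
set_option autoImplicit false

noncomputable section

open scoped Classical AddSubgroup Polynomial

universe u

namespace Summit.BirchSwinnertonDyer.BirchSwinnertonDyer.Theorems.AlignedTransportAtTwoHalfDescentLayerIndexGrowthFiniteTwistQuadratic

open WeierstrassCurve Literature.NumberTheory.EllipticCurves Literature.NumberTheory.EllipticCurves.IwasawaDual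
  Literature.NumberTheory.EllipticCurves.IwasawaAlgebra
  Literature.NumberTheory.EllipticCurves.QuadraticTwistSelmer
  Literature.NumberTheory.EllipticCurves.Greenberg1999
  Summit.BirchSwinnertonDyer.Rank1Residual.X1.MuLambda
  Summit.BirchSwinnertonDyer.Rank1Residual.Iwasawa
  Summit.BirchSwinnertonDyer.BirchSwinnertonDyer.Theorems
  Summit.BirchSwinnertonDyer.BirchSwinnertonDyer.Theorems.AlignedTransportAtTwoHalfDescentLayerIndexGrowthFinite
  Summit.BirchSwinnertonDyer.BirchSwinnertonDyer.Theorems.AlignedTransportAtTwoHalfDescentLayerIndexGrowthFiniteTwo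
  Summit.BirchSwinnertonDyer.BirchSwinnertonDyer.Theorems.AlignedTransportAtTwoHalfDescentLayerIndexGrowthFiniteCell
  Summit.BirchSwinnertonDyer.BirchSwinnertonDyer.Theorems.AlignedTransportAtTwoHalfDescentLayerIndexGrowthFiniteTwist
  Summit.BirchSwinnertonDyer.BirchSwinnertonDyer.Theorems.AlignedTransportAtTwoHalfDescentLayerIndexGrowthFiniteTwistMinus

/-! ## §1 The twisting datum for `W^{(d)}` at the first layer `K_1 = K(√d)`, and the injectivity of `res′` on the seed cell -/

section AnyField

variable {K : Type u} [Field K] [NumberField K] (W : WeierstrassCurve K) (κ : ZpExtension K 2) {γ : Field.absoluteGaloisGroup K}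
  {d : K} {θ : AlgebraicClosure K}

/-- **The twisting datum at the first layer.** For `θ² = d ≠ 0` with `Gal(K̄/K_1)` fixing `θ` and `γθ = −θ` (`K_1 = K(θ)`): the tree's
`Ψ = twistH1Equiv : H¹(K_1, W^{(d)}[2^∞]) ≃+ H¹(K_1, W[2^∞])` matches the Selmer groups (`mem_selmerGroupOver_iff_twist`) and ANTI-commutes with `conj_γ`
(`twistH1Equiv_conjH1`, `χ_θ(γ) = −1`). [cite: GreenbergLNM1716, §4 p. 107] [cite: Dokchitser2013ParityNotes, §4] [cite: SilvermanAEC2009, X.2 Prop. 2.4] -/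
theorem exists_twistDatum (hd : d ≠ 0) (hθ : θ ^ 2 = algebraMap K (AlgebraicClosure K) d)
    (hθ1 : ∀ σ : Field.absoluteGaloisGroup K, σ ∈ κ.layerSubgroup 1 → σ • θ = θ) (hγθ : γ • θ = -θ) :
    ∃ Ψ : (W.quadraticTwist d).subgroupH1 2 (κ.layerSubgroup 1) ≃+ W.subgroupH1 2 (κ.layerSubgroup 1),
      (∀ x, x ∈ (W.quadraticTwist d).selmerLayer κ 1 ↔ Ψ x ∈ W.selmerLayer κ 1) ∧
        ∀ x, Ψ ((W.quadraticTwist d).conjH1 2 (κ.layerSubgroup 1) γ x) = -(W.conjH1 2 (κ.layerSubgroup 1) γ (Ψ x)) := by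
  obtain ⟨C, hC⟩ := W.exists_variableChange_quadraticTwist_one
  refine ⟨twistH1Equiv W hC hd hθ 2 (κ.layerSubgroup 1) hθ1, fun x ↦ ?_, fun x ↦ ?_⟩
  · exact mem_selmerGroupOver_iff_twist W hC hd hθ 2 (κ.layerSubgroup 1) hθ1 x
  · rw [twistH1Equiv_conjH1 W hC hd hθ 2 (κ.layerSubgroup 1) hθ1 γ x,
      quadraticSign_of_smul_eq_neg (sqrt_ne_zero_of_sq_eq hd hθ) hγθ, neg_one_zsmul]

/-- **`W(K)[2] = 0 ⟹ W^{(d)}[2^∞]` has no non-zero point fixed by `Gal(K̄/K_1)`** (`K_1 ∋ √d`): the twist isomorphism `e_θ : W^{(d)}[2^∞] ≃ W[2^∞]` is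
`Gal(K̄/K_1)`-equivariant (`χ_θ = 1` there), and `W[2^∞]^{Gal(K̄/K_∞)} = 0` (tree `fixedPoints_kerSubgroup_geomPrimaryTorsion_eq_bot`, `Gal(K̄/K_∞) ≤ Gal(K̄/K_1)`).
[cite: GreenbergLNM1716, §1 p. 62, §4 p. 107] [cite: SilvermanAEC2009, X.2 Prop. 2.4] -/
theorem forall_fixed_quadraticTwist_eq_zero [W.IsElliptic] (hK : ∀ P : W.toAffine.Point, 2 • P = 0 → P = 0) (hd : d ≠ 0)
    (hθ : θ ^ 2 = algebraMap K (AlgebraicClosure K) d) (hθ1 : ∀ σ : Field.absoluteGaloisGroup K, σ ∈ κ.layerSubgroup 1 → σ • θ = θ) :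
    ∀ m : (W.quadraticTwist d).geomPrimaryTorsion 2, (∀ x ∈ κ.layerSubgroup 1, x • m = m) → m = 0 := by
  obtain ⟨C, hC⟩ := W.exists_variableChange_quadraticTwist_one
  intro m hm
  have hbot := W.fixedPoints_kerSubgroup_geomPrimaryTorsion_eq_bot κ hK
  have hem : primaryComponentCongr (twistGeomPointsEquiv W hC hd hθ) 2 m ∈ FixedPoints.addSubgroup κ.kerSubgroup (W.geomPrimaryTorsion 2) := by
    rw [FixedPoints.mem_addSubgroup]
    rintro ⟨τ, hτ⟩
    rw [Subgroup.mk_smul]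
    have hτ1 : τ ∈ κ.layerSubgroup 1 := κ.kerSubgroup_le_layerSubgroup 1 hτ
    have h := CoeffTwist.primaryComponentCongr_smul 2 (twistGeomPointsEquiv W hC hd hθ) (quadraticSign θ)
      (twistGeomPointsEquiv_smul_quadraticSign hd hθ W hC) τ m
    rw [hm τ hτ1, quadraticSign_of_smul_eq (hθ1 τ hτ1), one_zsmul] at h
    exact h.symm
  rw [hbot, AddSubgroup.mem_bot] at hem
  exact (map_eq_zero_iff _ (primaryComponentCongr (twistGeomPointsEquiv W hC hd hθ) 2).injective).mp hem

/-- **`W(K)[2] = 0 ⟹ res : H¹(K, W^{(d)}[2^∞]) → H¹(K_1, W^{(d)}[2^∞])` is injective** (inflation–restriction, tree `resOfLe_injective_of_forall_fixed_eq_zero`).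
[cite: GreenbergLNM1716, §3 Lemma 3.1] [cite: SerreLocalFields1979, VII.§6 Prop. 4] -/
theorem resOfLe_quadraticTwist_injective [W.IsElliptic] (hK : ∀ P : W.toAffine.Point, 2 • P = 0 → P = 0) (hd : d ≠ 0)
    (hθ : θ ^ 2 = algebraMap K (AlgebraicClosure K) d) (hθ1 : ∀ σ : Field.absoluteGaloisGroup K, σ ∈ κ.layerSubgroup 1 → σ • θ = θ) :
    Function.Injective ((W.quadraticTwist d).resOfLe 2 (κ.layerSubgroup_antitone (Nat.le_succ 0))) :=
  resOfLe_injective_of_forall_fixed_eq_zero (M := (W.quadraticTwist d).geomPrimaryTorsion 2) (κ.layerSubgroup_antitone (Nat.le_succ 0))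
    (forall_fixed_quadraticTwist_eq_zero W κ hK hd hθ hθ1)

/-! ## §2 The minus part at the first layer IS the `2^∞`-Selmer group of the twist over the base (any number field) -/

/-- ★★★ **`#Sel_{2^∞}(W^{(d)}/K) ∣ #M_1 ∣ #Sel_{2^∞}(W^{(d)}/K) · #M_1[2]`** for EVERY number field `K`, `ℤ₂`-extension `κ` with topological generator `γ` and first layer
`K_1 = K(√d)`, and `W` with `W(K)[2] = 0` — `M_1 = Sel_{2^∞}(W/K_1) ∩ ker(conj_γ + 1)` the minus part (= the kernel of the norm `N_{K_1/K}`, gen 57's signed object carrying the growth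
number `g_0 = #(X/ω_1X)/#(X/TX)` up to `#ker g_1`). [cite: DokchitserDokchitserAnnals2010, Lemma 4.14 (proof)] [cite: GreenbergLNM1716, §3 Lemma 3.1, §4 p. 107] [cite: Dokchitser2013ParityNotes, §4] -/
theorem natCard_selmerLayer_quadraticTwist_dvd_and_dvd [W.IsElliptic] (hK : ∀ P : W.toAffine.Point, 2 • P = 0 → P = 0) (hγ : κ.IsTopGenerator γ)
    (hd : d ≠ 0) (hθ : θ ^ 2 = algebraMap K (AlgebraicClosure K) d)
    (hθ1 : ∀ σ : Field.absoluteGaloisGroup K, σ ∈ κ.layerSubgroup 1 → σ • θ = θ) (hγθ : γ • θ = -θ) :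
    Nat.card ((W.quadraticTwist d).selmerLayer κ 0) ∣
        Nat.card ↥(W.selmerLayer κ 1 ⊓ (W.conjH1 2 (κ.layerSubgroup 1) γ + AddMonoidHom.id (W.subgroupH1 2 (κ.layerSubgroup 1))).ker) ∧
      Nat.card ↥(W.selmerLayer κ 1 ⊓ (W.conjH1 2 (κ.layerSubgroup 1) γ + AddMonoidHom.id (W.subgroupH1 2 (κ.layerSubgroup 1))).ker) ∣
        Nat.card ((W.quadraticTwist d).selmerLayer κ 0) *
          Nat.card ↥(W.selmerLayer κ 1 ⊓ (W.conjH1 2 (κ.layerSubgroup 1) γ + AddMonoidHom.id (W.subgroupH1 2 (κ.layerSubgroup 1))).ker ⊓ AddSubgroup.torsionBy (W.subgroupH1 2 (κ.layerSubgroup 1)) 2) := by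
  obtain ⟨Ψ, hΨsel, hΨγ⟩ := exists_twistDatum W κ hd hθ hθ1 hγθ
  have hΨg : ∀ x, Ψ ((W.quadraticTwist d).conjH1 2 (κ.layerSubgroup (0 + 1)) (γ ^ 2 ^ 0) x) =
      -(W.conjH1 2 (κ.layerSubgroup (0 + 1)) (γ ^ 2 ^ 0) (Ψ x)) := by
    simpa only [pow_zero, pow_one] using hΨγ
  have h := natCard_selmerLayer_twist_dvd_and_dvd_of_injective W (W.quadraticTwist d) κ 0 Ψ hγ hΨsel hΨg
    (resOfLe_quadraticTwist_injective W κ hK hd hθ hθ1)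
  simpa only [pow_zero, pow_one] using h

/-- ★★ **`#Sel_{2^∞}(W/K) · #Sel_{2^∞}(W^{(d)}/K) ∣ #Sel_{2^∞}(W/K_1) · #M_1[2]`** (`W(K)[2] = 0`, `K_1 = K(√d)` the first layer): the order form of `Sel(W/K) ⊕ Sel(W^{(d)}/K) ↪
Sel(W/K(√d))` up to the `2`-torsion of the minus part. [cite: DokchitserDokchitserAnnals2010, Lemma 4.14 (proof)] [cite: GreenbergLNM1716, §3 Lemmas 3.1–3.3] -/
theorem natCard_selmerLayer_mul_quadraticTwist_dvd [W.IsElliptic] (hK : ∀ P : W.toAffine.Point, 2 • P = 0 → P = 0) (hγ : κ.IsTopGenerator γ)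
    (hd : d ≠ 0) (hθ : θ ^ 2 = algebraMap K (AlgebraicClosure K) d)
    (hθ1 : ∀ σ : Field.absoluteGaloisGroup K, σ ∈ κ.layerSubgroup 1 → σ • θ = θ) (hγθ : γ • θ = -θ) :
    Nat.card (W.selmerLayer κ 0) * Nat.card ((W.quadraticTwist d).selmerLayer κ 0) ∣
      Nat.card (W.selmerLayer κ 1) *
        Nat.card ↥(W.selmerLayer κ 1 ⊓ (W.conjH1 2 (κ.layerSubgroup 1) γ + AddMonoidHom.id (W.subgroupH1 2 (κ.layerSubgroup 1))).ker ⊓ AddSubgroup.torsionBy (W.subgroupH1 2 (κ.layerSubgroup 1)) 2) := by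
  obtain ⟨Ψ, hΨsel, hΨγ⟩ := exists_twistDatum W κ hd hθ hθ1 hγθ
  have hΨg : ∀ x, Ψ ((W.quadraticTwist d).conjH1 2 (κ.layerSubgroup (0 + 1)) (γ ^ 2 ^ 0) x) =
      -(W.conjH1 2 (κ.layerSubgroup (0 + 1)) (γ ^ 2 ^ 0) (Ψ x)) := by
    simpa only [pow_zero, pow_one] using hΨγ
  have h := natCard_selmerLayer_mul_twist_dvd W (W.quadraticTwist d) κ 0 Ψ hK hγ hΨsel hΨg (resOfLe_quadraticTwist_injective W κ hK hd hθ hθ1)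
  simpa only [pow_zero, pow_one] using h

/-- ★★ **`#Sel_{2^∞}(W/K_1) ∣ #Sel_{2^∞}(W/K) · #Sel_{2^∞}(W^{(d)}/K) · #Sel⁺_1[2] · #M_1[2]`** (`K_1 = K(√d)` the first layer; no torsion hypothesis): the order form of
`Sel(W/K(√d)) → Sel(W/K) ⊕ Sel(W^{(d)}/K)` with explicit `2`-torsion defects (`Sel⁺_1 = Sel_{2^∞}(W/K_1) ∩ ker(conj_γ − 1)`).
[cite: DokchitserDokchitserAnnals2010, Lemma 4.14 (proof)] [cite: GreenbergLNM1716, §3 Lemmas 3.1–3.3] -/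
theorem natCard_selmerLayer_one_dvd (hγ : κ.IsTopGenerator γ)
    (hd : d ≠ 0) (hθ : θ ^ 2 = algebraMap K (AlgebraicClosure K) d)
    (hθ1 : ∀ σ : Field.absoluteGaloisGroup K, σ ∈ κ.layerSubgroup 1 → σ • θ = θ) (hγθ : γ • θ = -θ) :
    Nat.card (W.selmerLayer κ 1) ∣
      Nat.card (W.selmerLayer κ 0) * Nat.card ((W.quadraticTwist d).selmerLayer κ 0) *
          Nat.card ↥(W.selmerLayer κ 1 ⊓ (W.conjH1 2 (κ.layerSubgroup 1) γ - AddMonoidHom.id (W.subgroupH1 2 (κ.layerSubgroup 1))).ker ⊓ AddSubgroup.torsionBy (W.subgroupH1 2 (κ.layerSubgroup 1)) 2) *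
        Nat.card ↥(W.selmerLayer κ 1 ⊓ (W.conjH1 2 (κ.layerSubgroup 1) γ + AddMonoidHom.id (W.subgroupH1 2 (κ.layerSubgroup 1))).ker ⊓ AddSubgroup.torsionBy (W.subgroupH1 2 (κ.layerSubgroup 1)) 2) := by
  obtain ⟨Ψ, hΨsel, hΨγ⟩ := exists_twistDatum W κ hd hθ hθ1 hγθ
  have hΨg : ∀ x, Ψ ((W.quadraticTwist d).conjH1 2 (κ.layerSubgroup (0 + 1)) (γ ^ 2 ^ 0) x) =
      -(W.conjH1 2 (κ.layerSubgroup (0 + 1)) (γ ^ 2 ^ 0) (Ψ x)) := by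
    simpa only [pow_zero, pow_one] using hΨγ
  have h := natCard_selmerLayer_succ_dvd_mul_twist W (W.quadraticTwist d) κ 0 Ψ hγ hΨsel hΨg
  simpa only [pow_zero, pow_one] using h

/-- ★★ **`2^{μ(X(W/K_∞))} ∣ #Sel_{2^∞}(W^{(d)}/K) · #M_1[2] · #ker g_1`** (`W(K)[2] = 0`, `K_1 = K(√d)`, `X` finitely generated torsion, any rank): Greenberg's `μ`-invariant of
`X(W/K_∞)` is BOUNDED by the `2^∞`-descent of the twist `W^{(d)}` over the BASE `K`, the `2`-torsion of the minus part and the control kernel at `K_1`: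
`μ ≤ v₂#Sel_{2^∞}(W^{(d)}/K) + v₂#M_1[2] + v₂#ker g_1`. [cite: GreenbergLNM1716, Conj. 1.11, §3 Lemmas 3.1–3.3, §4 Lemma 4.3] [cite: Washington1997, §13.3 Thm. 13.13]
[cite: DokchitserDokchitserAnnals2010, Lemma 4.14 (proof)] -/
theorem pow_mu_dvd_quadraticTwist [W.IsElliptic] (hK : ∀ P : W.toAffine.Point, 2 • P = 0 → P = 0) (hγ : κ.IsTopGenerator γ)
    (hd : d ≠ 0) (hθ : θ ^ 2 = algebraMap K (AlgebraicClosure K) d)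
    (hθ1 : ∀ σ : Field.absoluteGaloisGroup K, σ ∈ κ.layerSubgroup 1 → σ • θ = θ) (hγθ : γ • θ = -θ)
    (D : W.SelmerDualData κ γ) [Module.Finite (IwasawaAlgebra 2) D.X] (hD : D.IsTorsion) :
    2 ^ D.mu ∣
      Nat.card ((W.quadraticTwist d).selmerLayer κ 0) *
          Nat.card ↥(W.selmerLayer κ 1 ⊓ (W.conjH1 2 (κ.layerSubgroup 1) γ + AddMonoidHom.id (W.subgroupH1 2 (κ.layerSubgroup 1))).ker ⊓ AddSubgroup.torsionBy (W.subgroupH1 2 (κ.layerSubgroup 1)) 2) *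
        Nat.card (W.KerG κ 1) := by
  obtain ⟨Ψ, hΨsel, hΨγ⟩ := exists_twistDatum W κ hd hθ hθ1 hγθ
  have hΨg : ∀ x, Ψ ((W.quadraticTwist d).conjH1 2 (κ.layerSubgroup (0 + 1)) (γ ^ 2 ^ 0) x) =
      -(W.conjH1 2 (κ.layerSubgroup (0 + 1)) (γ ^ 2 ^ 0) (Ψ x)) := by
    simpa only [pow_zero, pow_one] using hΨγ
  have h := pow_mu_dvd_natCard_selmerLayer_twist_mul W (W.quadraticTwist d) κ 0 Ψ hK hγ hΨsel hΨg D hD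
  simpa only [pow_zero, pow_one, one_mul] using h

end AnyField

/-! ## §3 `K = ℚ`, `κ` cyclotomic: `ℚ_1 = ℚ(√2)` and the twist `E^{(2)}` -/

section Rat

variable (W : WeierstrassCurve ℚ) [W.IsElliptic] (κ : ZpExtension ℚ 2) {γ : Field.absoluteGaloisGroup ℚ}

omit [W.IsElliptic] in
/-- Over `ℚ` with `κ` cyclotomic: a square root `θ` of `2` in `ℚ̄` is fixed by `Gal(ℚ̄/ℚ_1)` and negated by any topological generator `γ` (`ℚ_1 = ℚ(ζ₈)⁺ = ℚ(√2)`,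
tree `SteinbergFibreAtTwo.exists_sqrt_two_smul_eq_neg_of_isCyclotomic`; `κ γ = 1 ∉ 2ℤ₂`). [cite: Washington1997, §13.1] -/
theorem exists_sqrt_two_datum (hκ : κ.IsCyclotomic) (hγ : κ.IsTopGenerator γ) :
    ∃ θ : AlgebraicClosure ℚ, θ ^ 2 = algebraMap ℚ (AlgebraicClosure ℚ) 2 ∧
      (∀ σ : Field.absoluteGaloisGroup ℚ, σ ∈ κ.layerSubgroup 1 → σ • θ = θ) ∧ γ • θ = -θ := by
  obtain ⟨t, ht2, htfix, htneg⟩ := SteinbergFibreAtTwo.exists_sqrt_two_smul_eq_neg_of_isCyclotomic κ hκ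
  refine ⟨t, by rw [map_ofNat]; exact ht2, htfix, htneg γ fun hγ1 ↦ ?_⟩
  have hγ' : κ γ = Multiplicative.ofAdd 1 := hγ
  rw [ZpExtension.mem_layerSubgroup, hγ', toAdd_ofAdd, pow_one] at hγ1
  exact (Prime.not_dvd_one PadicInt.prime_p) hγ1

/-- ★★★ `K = ℚ`, `κ` cyclotomic, `E` elliptic WITHOUT a rational `2`-torsion abscissa (the crux binder): **`#Sel_{2^∞}(E^{(2)}/ℚ) ∣ #M_1 ∣ #Sel_{2^∞}(E^{(2)}/ℚ) · #M_1[2]`**,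
`M_1 = ker(N_{ℚ(√2)/ℚ} | Sel_{2^∞}(E/ℚ(√2)))` the minus part of the `2^∞`-Selmer group over the first cyclotomic layer `ℚ_1 = ℚ(√2)`, `E^{(2)} = E.quadraticTwist 2`.
[cite: DokchitserDokchitserAnnals2010, Lemma 4.14 (proof)] [cite: GreenbergLNM1716, §3 Lemma 3.1, §4 p. 107] [cite: Washington1997, §13.1] -/
theorem natCard_selmerLayer_quadraticTwist_two_dvd_and_dvd (hκ : κ.IsCyclotomic) (hγ : κ.IsTopGenerator γ) (ht : ∀ x : ℚ, ¬ HasRationalTwoTorsionX W x) :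
    Nat.card ((W.quadraticTwist 2).selmerLayer κ 0) ∣
        Nat.card ↥(W.selmerLayer κ 1 ⊓ (W.conjH1 2 (κ.layerSubgroup 1) γ + AddMonoidHom.id (W.subgroupH1 2 (κ.layerSubgroup 1))).ker) ∧
      Nat.card ↥(W.selmerLayer κ 1 ⊓ (W.conjH1 2 (κ.layerSubgroup 1) γ + AddMonoidHom.id (W.subgroupH1 2 (κ.layerSubgroup 1))).ker) ∣
        Nat.card ((W.quadraticTwist 2).selmerLayer κ 0) *
          Nat.card ↥(W.selmerLayer κ 1 ⊓ (W.conjH1 2 (κ.layerSubgroup 1) γ + AddMonoidHom.id (W.subgroupH1 2 (κ.layerSubgroup 1))).ker ⊓ AddSubgroup.torsionBy (W.subgroupH1 2 (κ.layerSubgroup 1)) 2) := by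
  obtain ⟨θ, hθ, hθ1, hγθ⟩ := exists_sqrt_two_datum κ hκ hγ
  exact natCard_selmerLayer_quadraticTwist_dvd_and_dvd W κ (forall_two_nsmul_eq_zero W ht) hγ two_ne_zero hθ hθ1 hγθ

/-- ★★ `K = ℚ`, `κ` cyclotomic, no rational `2`-torsion abscissa: **`#Sel_{2^∞}(E/ℚ) · #Sel_{2^∞}(E^{(2)}/ℚ) ∣ #Sel_{2^∞}(E/ℚ(√2)) · #M_1[2]`**.
[cite: DokchitserDokchitserAnnals2010, Lemma 4.14 (proof)] [cite: Washington1997, §13.1] -/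
theorem natCard_selmerLayer_mul_quadraticTwist_two_dvd (hκ : κ.IsCyclotomic) (hγ : κ.IsTopGenerator γ) (ht : ∀ x : ℚ, ¬ HasRationalTwoTorsionX W x) :
    Nat.card (W.selmerLayer κ 0) * Nat.card ((W.quadraticTwist 2).selmerLayer κ 0) ∣
      Nat.card (W.selmerLayer κ 1) *
        Nat.card ↥(W.selmerLayer κ 1 ⊓ (W.conjH1 2 (κ.layerSubgroup 1) γ + AddMonoidHom.id (W.subgroupH1 2 (κ.layerSubgroup 1))).ker ⊓ AddSubgroup.torsionBy (W.subgroupH1 2 (κ.layerSubgroup 1)) 2) := by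
  obtain ⟨θ, hθ, hθ1, hγθ⟩ := exists_sqrt_two_datum κ hκ hγ
  exact natCard_selmerLayer_mul_quadraticTwist_dvd W κ (forall_two_nsmul_eq_zero W ht) hγ two_ne_zero hθ hθ1 hγθ

omit [W.IsElliptic] in
/-- ★★ `K = ℚ`, `κ` cyclotomic, ANY `E/ℚ`: **`#Sel_{2^∞}(E/ℚ(√2)) ∣ #Sel_{2^∞}(E/ℚ) · #Sel_{2^∞}(E^{(2)}/ℚ) · #Sel⁺_1[2] · #M_1[2]`**. [cite: DokchitserDokchitserAnnals2010, Lemma 4.14 (proof)]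
[cite: Washington1997, §13.1] -/
theorem natCard_selmerLayer_one_dvd_two [W.IsElliptic] (hκ : κ.IsCyclotomic) (hγ : κ.IsTopGenerator γ) :
    Nat.card (W.selmerLayer κ 1) ∣
      Nat.card (W.selmerLayer κ 0) * Nat.card ((W.quadraticTwist 2).selmerLayer κ 0) *
          Nat.card ↥(W.selmerLayer κ 1 ⊓ (W.conjH1 2 (κ.layerSubgroup 1) γ - AddMonoidHom.id (W.subgroupH1 2 (κ.layerSubgroup 1))).ker ⊓ AddSubgroup.torsionBy (W.subgroupH1 2 (κ.layerSubgroup 1)) 2) *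
        Nat.card ↥(W.selmerLayer κ 1 ⊓ (W.conjH1 2 (κ.layerSubgroup 1) γ + AddMonoidHom.id (W.subgroupH1 2 (κ.layerSubgroup 1))).ker ⊓ AddSubgroup.torsionBy (W.subgroupH1 2 (κ.layerSubgroup 1)) 2) := by
  obtain ⟨θ, hθ, hθ1, hγθ⟩ := exists_sqrt_two_datum κ hκ hγ
  exact natCard_selmerLayer_one_dvd W κ hγ two_ne_zero hθ hθ1 hγθ

/-- ★★ `K = ℚ`, `κ` cyclotomic with topological generator `γ`, `E` elliptic without a rational `2`-torsion abscissa, `D` ANY Pontryagin-dual datum with `X` finitely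
generated torsion: **`2^{μ₂(X(E/ℚ_∞))} ∣ #Sel_{2^∞}(E^{(2)}/ℚ) · #M_1[2] · #ker g_1`** — the seed's only non-print input `μ₂ = 0` is CONTROLLED FROM ABOVE by the `2^∞`-Selmer
group of the twist `E^{(2)}` over `ℚ`, the `2`-torsion of the minus part over `ℚ(√2)` and Greenberg's control kernel at `ℚ(√2)`. Nothing numerical is asserted.
[cite: GreenbergLNM1716, Conj. 1.11, §3 Lemmas 3.1–3.3, §4 Lemma 4.3] [cite: Washington1997, §13.1, §13.3 Thm. 13.13] [cite: DokchitserDokchitserAnnals2010, Lemma 4.14 (proof)] -/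
theorem pow_mu_dvd_quadraticTwist_two (hκ : κ.IsCyclotomic) (hγ : κ.IsTopGenerator γ) (ht : ∀ x : ℚ, ¬ HasRationalTwoTorsionX W x)
    (D : W.SelmerDualData κ γ) [Module.Finite (IwasawaAlgebra 2) D.X] (hD : D.IsTorsion) :
    2 ^ D.mu ∣
      Nat.card ((W.quadraticTwist 2).selmerLayer κ 0) *
          Nat.card ↥(W.selmerLayer κ 1 ⊓ (W.conjH1 2 (κ.layerSubgroup 1) γ + AddMonoidHom.id (W.subgroupH1 2 (κ.layerSubgroup 1))).ker ⊓ AddSubgroup.torsionBy (W.subgroupH1 2 (κ.layerSubgroup 1)) 2) *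
        Nat.card (W.KerG κ 1) := by
  obtain ⟨θ, hθ, hθ1, hγθ⟩ := exists_sqrt_two_datum κ hκ hγ
  exact pow_mu_dvd_quadraticTwist W κ (forall_two_nsmul_eq_zero W ht) hγ two_ne_zero hθ hθ1 hγθ D hD

end Rat

end Summit.BirchSwinnertonDyer.BirchSwinnertonDyer.Theorems.AlignedTransportAtTwoHalfDescentLayerIndexGrowthFiniteTwistQuadratic

end
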